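import Summits.BirchSwinnertonDyer.BirchSwinnertonDyer.Theorems.GenusKolyvaginAtTwoK4NegPhantomFrameTraceBit
import Summits.BirchSwinnertonDyer.BirchSwinnertonDyer.Theorems.GenusKolyvaginAtTwoGenusPrimitiveSupplyAtTwoUnconditional
import HarnessLib

/-!
# Route `GenusKolyvaginAtTwo`, crux K₄⁻ `K4Neg` (stmt-BirchSwinnertonDyer-31526), LINE 34 phantom cell F4ᵖᵍ —
# THE TWIN'S `Sel₂` ALONG THE TRACE BIT: on a Selmer-entangled K₄ curve every (α)-frame prime carries a `Sel₂`-minimal twin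

Width seat `bsd-line-gk2-p4` g34 (cell `bsd-f1-sign2`), WIDTH-5 attach on route `GenusKolyvaginAtTwo` rev 59; sequel of
`…K4NegPhantomFrameTraceBit` (p789093) and `…K4NegPhantomFrameEntangledIffTrace` (p789412).
`--supports stmt-BirchSwinnertonDyer-31526 --as helper`.  THEOREMS ONLY (no definition, no named fact, no `sorry`); standard axioms; UNCONDITIONAL
(Mazur–Rubin Cor. 3.4 (i) is the tree theorem `GenusKolyPR.cor34i_twin_prime_heegner`, gk2-p4 g12 + the LEAD's unconditional packaging).
**BSD is NOT proved by this file; `K4Neg` is NOT proved; no item is closed by it.**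

WHAT.  `W/ℚ` globally minimal, `Δ < 0`, `ρ̄_{W,2}`, `ρ_{W,4}` onto, `#Sel₂(W) = 4` (the K₄ cell) and SELMER-ENTANGLED: the Lawson–Wuthrich class `ξ_W`
(`≠ 0`, dying on `Γ_{ℚ(E[4])}`) lies in `Sel₂(W)` (the 2-adic bit FALSE: the good-supersingular and the tested additive cells of F4ᵖᵍ).  `K = ℚ(√−ℓ₀)` a
prime Heegner field (odd `d_K = −ℓ₀`, Heegner, `2` split), `Wd` a model of the twin `W^{(d_K)}`, `γ` an arithmetic Frobenius at `ℓ₀` acting on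
`E[2]` as an involution `≠ 1`.  Mazur–Rubin's one-prime law (`cor34i_twin_prime_heegner`): `#Sel₂(Wd) = 2·#Sel₂(W)` if `Sel₂(W)` is strict at `ℓ₀`,
`#Sel₂(W) = 2·#Sel₂(Wd)` otherwise.  The trace bit decides strictness OF `ξ_W`: `loc_{ℓ₀} ξ_W = 0 ⟺ 4 ∣ a_{ℓ₀}` (p789093 §4).  Hence:

* ★ `natCard_selmerGroup_twin_eq_two_of_selmer_dying_of_not_four_dvd` — **(α): `a_{ℓ₀} ≢ 0 (mod 4)` ⟹ `#Sel₂(Wd) = 2`** — EVERY (α)-frame prime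
  of a Selmer-entangled K₄ curve carries a `Sel₂`-minimal twin (no Čebotarev choice needed for the twin clause of the supply; memo P2).
* `natCard_selmerGroup_twin_of_natCard_selmerGroup_eq_four` — **(β): `4 ∣ a_{ℓ₀}` ⟹ `#Sel₂(Wd) = 8` if ALL of `Sel₂(W)` is strict at `ℓ₀`, `= 2` otherwise** — the
  (β)-primes split once more by the visible classes `s′, s′ + ξ_W` of `Sel₂(W)` (memo P1/P3: `Sel₂`-minimal twins at `3/4` of the admissible
  primes; the (β)-frames are `1/3` of the actual K₄⁻ frames).

READING (LINE 34 census; nothing closed).  Together with p789412: a prime Heegner frame of a Selmer-entangled K₄⁻ curve is a (β)-frame of the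
LEAD road (`hHalf` fails) iff `4 ∣ a_{ℓ₀}` AND some class of `Sel₂(W)` is alive at `ℓ₀`; it is an (α)-frame (road applies) iff `a_{ℓ₀} ≡ 2 (4)`,
and then the twin clause `#Sel₂(Wd) = 2` of the frame is AUTOMATIC.  BSD is NOT proved by any of this.

References: [MazurRubin2010] Cor. 3.4 (i), Prop. 3.3, Lemma 2.2; [LawsonWuthrich2016] §3, §7.1; [Kramer1981] Thm. 1; [GrossLMS1991] §9 Prop. 9.6.
-/

set_option linter.dupNamespace false -- `Summit.<P>.<Sub>` repeats `BirchSwinnertonDyer` (D-0017)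
set_option autoImplicit false

noncomputable section

open scoped Classical Pointwise

namespace Summit.BirchSwinnertonDyer.BirchSwinnertonDyer.Theorems.GenusExact.PhantomDescentBit.TraceBit

open WeierstrassCurve Field NumberField IsDedekindDomain
open Literature.NumberTheory.GaloisRepresentations Literature.NumberTheory.EllipticCurves
open Literature.NumberTheory
open Rat.HeightOneSpectrum (primesEquiv)
open Summit.BirchSwinnertonDyer.BirchSwinnertonDyer.Theorems.GenusKolyTwistingPrime

variable (W : WeierstrassCurve ℚ) [W.IsElliptic] [W.IsGloballyMinimal] {K : Type} [Field K] [NumberField K]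

/-- ★ **(α): EVERY (α)-FRAME PRIME OF A SELMER-ENTANGLED K₄ CURVE CARRIES A `Sel₂`-MINIMAL TWIN.**  `W/ℚ` globally minimal, `Δ < 0`, `ρ̄_{W,2}`
and `ρ_{W,4}` onto, `#Sel₂(W) = 4`, `x ∈ Sel₂(W)` non-zero and dying on `Γ_{ℚ(E[4])}` (the Lawson–Wuthrich class, `x = ξ_W`); `K` imaginary quadratic
with odd `d_K = −ℓ₀` (`ℓ₀` prime), Heegner for `N_W`, `2` split; `Wd` an elliptic model of `W^{(d_K)}`; `γ` an arithmetic Frobenius at a prime above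
`ℓ₀` acting on `E[2]` as an involution `≠ 1`.  If `¬ 4 ∣ a_{ℓ₀}(W)` then **`#Sel₂(Wd) = 2`**: by the trace bit `x` is alive at `ℓ₀`, so `Sel₂(W)` is
not strict there, and Mazur–Rubin's one-prime law halves the Selmer group. [cite: MazurRubin2010, Cor. 3.4 (i), Prop. 3.3]
[cite: LawsonWuthrich2016, §3] [cite: GrossLMS1991, §9 Prop. 9.6] -/
theorem natCard_selmerGroup_twin_eq_two_of_selmer_dying_of_not_four_dvd
    (hsurj : W.HasSurjectiveModNGaloisRep 2) (hsurj4 : W.HasSurjectiveModNGaloisRep 4) (hΔ : W.Δ < 0)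
    (h4W : Nat.card (W.selmerGroup 2) = 4)
    {x : galH1Torsion W (2 : ℤ)} (hxS : x ∈ W.selmerGroup 2) (hx0 : x ≠ 0)
    (hx : ∀ h ∈ torsionFixing W (4 : ℤ), h1Eval W (2 : ℤ) x h = 0)
    (hK : IsImaginaryQuadratic K) (hodd : Odd (discr K)) (hH : SatisfiesHeegnerHypothesis (W.conductorNorm ℤ) K)
    (h2K : ((Ideal.span {(2 : ℤ)}).primesOver (𝓞 K)).ncard = 2)
    {ℓ : ℕ} [Fact ℓ.Prime] (hd : discr K = -(ℓ : ℤ)) (Wd : WeierstrassCurve ℚ) [Wd.IsElliptic]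
    (hWd : ∃ C : VariableChange ℚ, C • W.quadraticTwist (discr K : ℚ) = Wd)
    {v : HeightOneSpectrum (𝓞 ℚ)} (hℓv : (ℓ : 𝓞 ℚ) ∈ v.asIdeal) {𝔓₀ : Ideal (absIntegers (𝓞 ℚ) ℚ)}
    (h𝔓₀ : 𝔓₀ ∈ v.primesAbove) {γ : absoluteGaloisGroup ℚ} (hγ : IsArithFrobAt (𝓞 ℚ) γ 𝔓₀)
    (hinv : ∀ T : geomTorsion W (2 : ℤ), γ • γ • T = T) (hγT : ∃ T : geomTorsion W (2 : ℤ), γ • T ≠ T)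
    (h4 : ¬ (4 : ℤ) ∣ W.frobeniusTrace ℓ) :
    Nat.card (Wd.selmerGroup 2) = 2 := by
  have hℓ : ℓ.Prime := Fact.out
  obtain ⟨hℓ2, hℓN, -⟩ := GenusKolyTwin.prime_discr_facts W hK hodd hH hℓ hd
  have hW : W.HasGoodReductionAt v := by
    by_contra h
    exact hℓN ((primesEquiv_eq hℓ hℓv) ▸ (W.dvd_conductorNorm_iff v).mpr h)
  -- `x` is alive at `ℓ₀`
  have hxloc : x ∉ W.torsionLocalKer ℚ_[ℓ] (2 : ℤ) := fun hmem ↦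
    h4 ((mem_torsionLocalKer_padic_iff_four_dvd_frobeniusTrace W hsurj hsurj4 hx0 hx hℓ2 hℓv hW h𝔓₀ hγ hinv hγT).mp hmem)
  have hns : ¬ W.selmerGroup 2 ≤ MazurRubin2010.strictLocalKer W ℚ_[ℓ] 2 := fun hle ↦ by
    have h := hle hxS
    rw [strictLocalKer_eq_torsionLocalKer] at h
    exact hxloc h
  have hlaw := (GenusKolyPR.cor34i_twin_prime_heegner W hsurj hΔ hK hodd hH h2K hd Wd hWd).2 hns
  rw [h4W] at hlaw
  omega

/-- **The twin's `Sel₂` on the K₄ cell (`#Sel₂(W) = 4`), both cases of Mazur–Rubin's one-prime law in `torsionLocalKer` currency.**  At a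
(β)-frame prime (`4 ∣ a_{ℓ₀}`) the Lawson–Wuthrich class is strict at `ℓ₀` (p789093 §4), so the law is decided by the visible classes: **`#Sel₂(Wd) = 8` if every class of `Sel₂(W)` is strict at `ℓ₀`, and
`#Sel₂(Wd) = 2` otherwise** (`#Sel₂(W) = 4`).  On the Selmer-entangled K₄ cell (`Sel₂(W) = {0, ξ, s′, s′ + ξ}`) the first case is «`loc_{ℓ₀} s′ = 0`»:
that (β)-prime is then NOT a K₄⁻ frame (`#Sel₂(Wd) ≠ 2`). [cite: MazurRubin2010, Cor. 3.4 (i), Prop. 3.3] [cite: Kramer1981, Thm. 1] -/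
theorem natCard_selmerGroup_twin_of_natCard_selmerGroup_eq_four
    (hsurj : W.HasSurjectiveModNGaloisRep 2) (hΔ : W.Δ < 0) (h4W : Nat.card (W.selmerGroup 2) = 4)
    (hK : IsImaginaryQuadratic K) (hodd : Odd (discr K)) (hH : SatisfiesHeegnerHypothesis (W.conductorNorm ℤ) K)
    (h2K : ((Ideal.span {(2 : ℤ)}).primesOver (𝓞 K)).ncard = 2)
    {ℓ : ℕ} [Fact ℓ.Prime] (hd : discr K = -(ℓ : ℤ)) (Wd : WeierstrassCurve ℚ) [Wd.IsElliptic]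
    (hWd : ∃ C : VariableChange ℚ, C • W.quadraticTwist (discr K : ℚ) = Wd) :
    (W.selmerGroup 2 ≤ W.torsionLocalKer ℚ_[ℓ] (2 : ℤ) → Nat.card (Wd.selmerGroup 2) = 8) ∧
      (¬ W.selmerGroup 2 ≤ W.torsionLocalKer ℚ_[ℓ] (2 : ℤ) → Nat.card (Wd.selmerGroup 2) = 2) := by
  have hlaw := GenusKolyPR.cor34i_twin_prime_heegner W hsurj hΔ hK hodd hH h2K hd Wd hWd
  rw [strictLocalKer_eq_torsionLocalKer, h4W] at hlaw
  exact ⟨fun h ↦ by have := hlaw.1 h; omega, fun h ↦ by have := hlaw.2 h; omega⟩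

/-- **(β)-frame ⟹ some class of `Sel₂(W)` is alive at `ℓ₀`.**  Contrapositive reading for the K₄⁻ frames: if `#Sel₂(Wd) = 2` (part of every K₄⁻
frame) then NOT all of `Sel₂(W)` is strict at `ℓ₀`; at a (β)-prime (`ξ_W` strict) this is a visible class `s′` with `loc_{ℓ₀} s′ ≠ 0` — the
Čebotarev bit that thins the (β)-frames to one third of the K₄⁻ frames (memo P3). [cite: MazurRubin2010, Cor. 3.4 (i)] -/
theorem not_selmerGroup_le_torsionLocalKer_of_natCard_twin_eq_two
    (hsurj : W.HasSurjectiveModNGaloisRep 2) (hΔ : W.Δ < 0) (h4W : Nat.card (W.selmerGroup 2) = 4)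
    (hK : IsImaginaryQuadratic K) (hodd : Odd (discr K)) (hH : SatisfiesHeegnerHypothesis (W.conductorNorm ℤ) K)
    (h2K : ((Ideal.span {(2 : ℤ)}).primesOver (𝓞 K)).ncard = 2)
    {ℓ : ℕ} [Fact ℓ.Prime] (hd : discr K = -(ℓ : ℤ)) (Wd : WeierstrassCurve ℚ) [Wd.IsElliptic]
    (hWd : ∃ C : VariableChange ℚ, C • W.quadraticTwist (discr K : ℚ) = Wd) (h2 : Nat.card (Wd.selmerGroup 2) = 2) :
    ¬ W.selmerGroup 2 ≤ W.torsionLocalKer ℚ_[ℓ] (2 : ℤ) := fun hle ↦ by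
  have h8 := (natCard_selmerGroup_twin_of_natCard_selmerGroup_eq_four W hsurj hΔ h4W hK hodd hH h2K hd Wd hWd).1 hle
  omega

end Summit.BirchSwinnertonDyer.BirchSwinnertonDyer.Theorems.GenusExact.PhantomDescentBit.TraceBit

end
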